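import Summits.QuantumFields.YangMills.Theses.BalabanLadder
import Summits.QuantumFields.YangMills.Theorems.IR.DefectChainPriceDefs
import Summits.QuantumFields.YangMills.Theorems.IR.DefectChainDominationEngine
import Summits.QuantumFields.YangMills.Theorems.IR.DefectChainRarity

/-!
# Line `defect-chain-price` for crux `IR` (stmt-QuantumFields-19354, `Theses.BalabanLadder.IR`)
# — lens «disagreement percolation beyond the Dobrushin ball» (ideator ym-ir-idea-3, cell pub/ym-ir, R350 (B))

HONEST FRAMING.  Nothing here proves the Yang–Mills mass gap (Clay), the crux `IR`, or any clustering statement;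
R4 closes only the conditional finite-𝕋⁴ rung `BalabanLadder.UV`.  This file is a CHECKED SKELETON: three stubs (ONE
`sorry`'d) and a kernel-checked composition `IR_of` concluding the route decl BY NAME.

**v2 (2026-08-28, pooled prover ym-ir-line-pool-p3 g13) — «no mechanism; bank the engine» EXECUTED.**  The line was
STRUCK as typed (ym-ir-crit-1∕2: S2 is crux-equivalent) and WITHDRAWN by the ideator (2026-08-27T23:49Z), with the answer
«bank the engine (S1 `ChainRarity`, S3 `DominationEngine`)» (→ director, 23:59:58Z).  Both supports are now TREE THEOREMS and
the vocabulary (§1) and the three statements (§2) are TREE CONSTANTS (`Theorems/IR/DefectChainPriceDefs.lean`, p646125,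
namespace `…Cruxes.IR.DefectChain`, VERBATIM the v1 text): `stub_chainRarity := DefectChain.chainRarity_holds`
(`Theorems/IR/DefectChainRarity.lean` + `…RarityCount.lean`: chessboard Peierls at the correlation scale, exactly the route
predicted in §2's docstring — tree `OddTorusChessboard.measureReal_forall_le_cellAction_le_pow_rep_sharp` with cells = whole
chains, residue classes mod 3, union bound over `≤ (8ℓ⁴·6·3750^k)^{#F}` chain assignments, `p = q^{1/3} → 0`), and
`stub_dominationEngine := dominationEngine_holds` (`Theorems/IR/DefectChainDominationEngine.lean`, p636154, pool-p3 g10).  The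
in-file copies of §1–§2 are deleted (this file now `open`s the tree constants); §4–§5 are byte-identical to v1.  Sorries: ONE
— the load S2 `stub_pricedClustering` (crux-equivalent, OPEN; no mechanism).  The line stays WITHDRAWN; nothing is registered.

THE LINE (what percolates are lattice-scale DEFECTS, not field values).  A plaquette `q` of the torus `(ℤ/(2S+1)ℤ)⁴`
is a DEFECT of `U` when its Wilson cost `N − Re tr ρ(U_q) ≥ 1` (order-one threshold; for faithful `ρ` = a genuinely
large field, for centre-blind `ρ` = every `π₁`-monopole cube carries one, by the lattice Bianchi identity).  Single
defects have density `e^{−cβ}` in lattice units (chessboard, Mack–Pietarinen (1.6)) but are DENSE per correlation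
4-volume `ξ⁴ ≍ a(β)⁻⁴` — the Mack–Pietarinen wall («insufficient to guarantee that they become unimportant
dynamically», Rebbi reprint p. 568).  The lever: only DEFECT CHAINS of `k(β) = ⌈log(1/a(β))⌉ ≍ log ξ` distinct
plaquettes (consecutive base points at sup-distance `≤ 2`) are charged; a coarse box of side `ℓ(β) = ⌈θ/a(β)⌉ ≍ θξ`
on the time-axis tube is BAD when such a chain starts in it.  Bad boxes are RARE at the correlation scale and
HEREDITARILY DOMINATED (`stub_chainRarity`, chessboard Peierls: `ℓ⁴ C^k δ(β)^{k/5} → 0` because both `δ(β)` and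
`a(β)` are exponential in `β` while the chain length grows), and the bulk is asked for its full-rate decay only in
the ANNEALED-PRICED format `stub_pricedClustering`: `|⟨A;τ_n B⟩| ≤ C · E_μ[t^{#bad boxes on the tube}] · e^{−c₁ a(β) n}`
— a factor `t ≥ 1` of slack per bad box, paid INSIDE the torus expectation (no exterior data, no kernels, no window
certificate: the `MonopoleWire`/`WildWire`/`MassWire` refutations of boundary-uniform formats cannot be instantiated —
on the torus the monopole current is closed and nothing is imposed from outside).  The disagreement-percolation
engine `stub_dominationEngine` is pure probability: hereditary `p`-domination of the bad-box indicators gives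
`E[t^{#bad}] ≤ e^{(t−1)p m}`, affordable against `e^{−c₁ a n}` as soon as `p(β) ≤ c₁θ/(2t)` — NO smallness /
uniqueness-regime hypothesis on the bulk («beyond the Dobrushin ball»: the bulk enters only through the priced stub).
`IR_of` is the bookkeeping: `c₁ ↦ c₁/2`, `β₂ ↦ max β₂ β₃`.

WHY THE PRICED FORMAT IS NOT `IR` IN COSTUME.  `GapInUnits ⇒ stub_pricedClustering` with `t = 1` (it is WEAKER than
the crux conclusion outright); the converse needs exactly `stub_chainRarity` + `stub_dominationEngine`, i.e. the
line PROVES that the large-field ∕ monopole side of the IR problem can be priced away at the correlation scale and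
leaves the prover of the priced stub free to discard every coarse box met by a long defect chain (Bałaban's
small-field region is where RG technology works; the priced stub asks it for ONE output: rate-`a(β)` decay across
good boxes, losses `t` per bad box, in the mean).
-/

set_option autoImplicit false

noncomputable section

open MeasureTheory Filter Topology
open Literature.MathematicalPhysics.QuantumFieldTheory Literature.MathematicalPhysics.QuantumLattice
open Summit.QuantumFields.YangMills.Cruxes.OSLegsFromFemtoAndGap.DlrCollarTransfer (GapInUnits LowerBounds)

namespace Summit.QuantumFields.YangMills.Cruxes.IR.DefectChainPrice

/-! ## §1–§2 Vocabulary and stub statements: TREE CONSTANTS since v2 (`Theorems/IR/DefectChainPriceDefs.lean`, VERBATIM v1) -/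

open Summit.QuantumFields.YangMills.Cruxes.IR.DefectChain
  (znorm siteDist tubeBox HasDefectChain badBox badCount scaleL chainK ChainRarity PricedClustering DominationEngine)

/-! ## §3 Registered stubs -/

/-- S1 — hereditary chessboard-Peierls rarity of bad boxes at the correlation scale (support, M∕L) — PROVED (v2):
`Theorems/IR/DefectChainRarity.lean`. -/
theorem stub_chainRarity : ChainRarity :=
  Summit.QuantumFields.YangMills.Cruxes.IR.DefectChain.chainRarity_holds

/-- S2 — annealed-priced clustering at rate `a(β)` (the line's crux, XL). -/
theorem stub_pricedClustering : PricedClustering := by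
  sorry

/-- S3 — the domination engine (support, M) — PROVED (v2): `Theorems/IR/DefectChainDominationEngine.lean` (statement unfolded
there; `DominationEngine` is its verbatim `Prop` name). -/
theorem stub_dominationEngine : DominationEngine :=
  dominationEngine_holds

/-! ## §4 The composition, kernel-checked: `S1 → S2 → S3 → Theses.BalabanLadder.IR` -/

/-- Arithmetic of the engine: the annealed price is affordable against half the rate. -/
theorem price_affordable {t p θ c₁ aβ : ℝ} {n m ℓ : ℕ} (ht : 1 ≤ t) (_hp : 0 ≤ p) (hθ : 0 < θ) (hc₁ : 0 < c₁)
    (ha : 0 < aβ) (hpε : p ≤ c₁ * θ / (2 * t)) (hℓ : θ / aβ ≤ ℓ) (hm : (m : ℝ) ≤ n / ℓ) :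
    (t - 1) * p * m ≤ c₁ / 2 * aβ * n := by
  have ht0 : 0 < t := by linarith
  have hℓ0 : (0 : ℝ) < ℓ := lt_of_lt_of_le (div_pos hθ ha) hℓ
  have hm' : (m : ℝ) ≤ n * aβ / θ := by
    calc (m : ℝ) ≤ n / ℓ := hm
      _ ≤ n / (θ / aβ) := by
          apply div_le_div_of_nonneg_left (by positivity) (div_pos hθ ha) hℓ
      _ = n * aβ / θ := by rw [div_div_eq_mul_div]
  calc (t - 1) * p * m ≤ (t - 1) * (c₁ * θ / (2 * t)) * (n * aβ / θ) := by
        gcongr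
    _ = (t - 1) / t * (c₁ / 2 * aβ * n) := by
        field_simp
    _ ≤ 1 * (c₁ / 2 * aβ * n) := by
        apply mul_le_mul_of_nonneg_right _ (by positivity)
        rw [div_le_one ht0]; linarith
    _ = c₁ / 2 * aβ * n := one_mul _

/-- **`IR_of`: the three stubs imply the ROUTE DECL `Theses.BalabanLadder.IR` by name** (real proof, no `sorry`
outside the stubs): instantiate S2, take `p` from S1 at S2's `θ`, choose `β₃` with `p(β) < c₁θ/(2t)` beyond it,
bound the annealed price by S3 and `price_affordable`, and conclude `GapInUnits` with rate `c₁/2`. -/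
theorem IR_of (h₁ : ChainRarity) (h₂ : PricedClustering) (h₃ : DominationEngine) :
    Summit.QuantumFields.YangMills.Theses.BalabanLadder.IR := by
  intro G _ _ _ _ hG
  letI : MeasurableSpace G := borel G
  haveI : BorelSpace G := ⟨rfl⟩
  intro r a ha ha0 hlb
  obtain ⟨θ, t, c₁, β₂, S₁, hθ, ht, hc₁, hAB⟩ := h₂ G hG r a ha ha0 hlb
  obtain ⟨p, hp0, hpnn, hher⟩ := h₁ G hG r a ha ha0 θ hθ
  have ht0 : 0 < t := by linarith
  have hε : 0 < c₁ * θ / (2 * t) := by positivity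
  obtain ⟨β₃, hβ₃⟩ := Filter.eventually_atTop.1 (hp0.eventually (Iio_mem_nhds hε))
  refine ⟨c₁ / 2, max β₂ β₃, S₁, by positivity, fun A B => ?_⟩
  obtain ⟨C, hC0, hC⟩ := hAB A B
  refine ⟨C, fun β hβ S n hS hn => ?_⟩
  have hβ2 : β₂ ≤ β := le_trans (le_max_left _ _) hβ
  have hβ3 : β₃ ≤ β := le_trans (le_max_right _ _) hβ
  -- notation
  set ℓ : ℕ := scaleL a θ β with hℓdef
  set k : ℕ := chainK a β with hkdef
  set m : ℕ := n / ℓ with hmdef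
  set μ := wilsonMeasure (d := 4) (L := 2 * S + 1) r.ρ β with hμ
  haveI : IsProbabilityMeasure μ := isProbabilityMeasure_wilsonMeasure (d := 4) (L := 2 * S + 1) (G := G) r.ρ r.continuous β
  -- the coarse scale is at least `θ / a β`, and the boxes fit in the torus
  have hℓge : θ / a β ≤ (ℓ : ℝ) := Nat.le_ceil _
  have hℓpos : 0 < ℓ := Nat.ceil_pos.2 (div_pos hθ (ha β))
  have hmS : m * ℓ ≤ S := le_trans (Nat.div_mul_le_self n ℓ) hn
  have hmle : (m : ℝ) ≤ n / ℓ := Nat.cast_div_le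
  -- S3 applied to the bad boxes, fed by S1
  have hI : (∫ U, t ^ badCount r.ρ k ℓ m U ∂μ) ≤ Real.exp ((t - 1) * p β * m) := by
    have h := h₃ (GaugeConfig 4 (2 * S + 1) G) μ (fun j => badBox r.ρ k ℓ j) m (p β) t (hpnn β) ht
      (fun F hF => hher β S m hmS F hF)
    simpa [badCount] using h
  have hprice : (t - 1) * p β * m ≤ c₁ / 2 * a β * n :=
    price_affordable ht (hpnn β) hθ hc₁ (ha β) (hβ₃ β hβ3).le hℓge hmle
  have hmain := hC β hβ2 S n hS hn
  calc |latticeConnectedCorr r.ρ β (2 * S + 1) A.F B.F n|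
      ≤ C * (∫ U, t ^ badCount r.ρ k ℓ m U ∂μ) * Real.exp (-(c₁ * a β * n)) := hmain
    _ ≤ C * Real.exp ((t - 1) * p β * m) * Real.exp (-(c₁ * a β * n)) := by gcongr
    _ ≤ C * Real.exp (c₁ / 2 * a β * n) * Real.exp (-(c₁ * a β * n)) := by gcongr
    _ = C * Real.exp (-(c₁ / 2 * a β * n)) := by
        rw [mul_assoc, ← Real.exp_add]
        ring_nf

/-- The composition applied to the registered stubs (so the slot reads `IR` off the three stubs by name). -/
theorem IR_from_stubs : Summit.QuantumFields.YangMills.Theses.BalabanLadder.IR :=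
  IR_of stub_chainRarity stub_pricedClustering stub_dominationEngine

/-! ## §5 Format sanity: the priced stub is WEAKER than the crux conclusion (`t = 1`) -/

/-- `GapInUnits` implies the priced inequality with `t = 1` (no price): S2 is no stronger than `IR`'s conclusion. -/
theorem pricedClustering_shape_of_gapInUnits
    (G : Type) [Group G] [TopologicalSpace G] [IsTopologicalGroup G] [CompactSpace G]
    [MeasurableSpace G] [BorelSpace G] (r : LatticeRep G) (a : ℝ → ℝ) (θ : ℝ)
    (h : GapInUnits G r a) :
    ∃ (t c₁ β₂ : ℝ) (S₁ : ℝ → ℕ), 1 ≤ t ∧ 0 < c₁ ∧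
      ∀ A B : YMSpecies G, ∃ C : ℝ, ∀ β : ℝ, β₂ ≤ β → ∀ S n : ℕ, S₁ β ≤ S → n ≤ S →
        |latticeConnectedCorr r.ρ β (2 * S + 1) A.F B.F n| ≤
          C * (∫ U, t ^ badCount r.ρ (chainK a β) (scaleL a θ β) (n / scaleL a θ β) U
                ∂(wilsonMeasure (d := 4) (L := 2 * S + 1) r.ρ β)) * Real.exp (-(c₁ * a β * n)) := by
  obtain ⟨c₁, β₂, S₁, hc₁, hAB⟩ := h
  refine ⟨1, c₁, β₂, S₁, le_rfl, hc₁, fun A B => ?_⟩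
  obtain ⟨C, hC⟩ := hAB A B
  refine ⟨C, fun β hβ S n hS hn => ?_⟩
  haveI : IsProbabilityMeasure (wilsonMeasure (d := 4) (L := 2 * S + 1) r.ρ β) :=
    isProbabilityMeasure_wilsonMeasure (d := 4) (L := 2 * S + 1) (G := G) r.ρ r.continuous β
  simpa [one_pow] using hC β hβ S n hS hn

end Summit.QuantumFields.YangMills.Cruxes.IR.DefectChainPrice

end
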